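import Literature.AlgebraicGeometry.Frobenioids.AngularFrobenioids
import Literature.AlgebraicGeometry.Frobenioids.IsometricPreStepsPullback
import HarnessLib

/-!
# Frobenioids II, Example 3.3 (iii): the wide subcategory of isometries of a Frobenioid — dictionary

Mochizuki, *The geometry of Frobenioids II: poly-Frobenioids*, Kyushu J. Math. **62** (2008)
401–460, §3, Example 3.3 (iii), author's text pp. 28–29: "Write `A₀` (respectively, `A`) for the
subcategory of `C₀` (respectively, `C`) determined by the *isometries* … a routine verification
reveals that `A` satisfies the conditions of [Mzk5], Definition 1.3, hence that `A` is a *Frobenioid*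
over the base category `D`, which is, in fact, of *group-like* type"
[cite: MochizukiFrdII2008, Ex 3.3 (iii) p.29].

This PROOF-ONLY file (no definition) carries out the part of that routine verification which holds
for the wide subcategory of isometries `𝒲 ⊆ C` of ANY pre-Frobenioid `C → F_Φ`, with its structure
`(Base, 0, deg_Fr)` over the zero monoid (abc-iut-L1-t6's `PreFrobenioid.isometriesToElem`): the
dictionary between [FrdI] Def. 1.2 for `𝒲 → F_0` and for `C → F_Φ` on isometric arrows —
isomorphisms, linear / base-isomorphic / pre-step (tautological), co-angular (by two-out-of-three for
isometries, [FrdI] Prop. 1.7 (v)), Frobenius type, isotropic objects, and pull-back morphisms (via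
[FrdI] Def. 1.3 (i)(c) of `C`).
-/

namespace Literature.AlgebraicGeometry.Frobenioids

open CategoryTheory Opposite

universe w v v' u u'

namespace PreFrobenioid

namespace Isometries

variable {D : Type u} [Category.{v} D] {Φ : Dᵒᵖ ⥤ CommMonCat.{w}}
  {C : Type u'} [Category.{v'} C] {F : C ⥤ ElemFrobenioid Φ}

/-! ### The dictionary (tautological part) -/

/-- Arrows of `𝒲` are isometries of `C`. [cite: MochizukiFrdII2008, Ex 3.3 (iii) p.29] -/
theorem isIsometry_val {X Y : WideSubcategory (isometricMorphisms F)} (φ : X ⟶ Y) :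
    IsIsometry F φ.1 := φ.2

/-- Every arrow of `𝒲 → F_0` is an isometry. [cite: MochizukiFrdII2008, Ex 3.3 (iii) p.29] -/
theorem isIsometry {X Y : WideSubcategory (isometricMorphisms F)} (φ : X ⟶ Y) :
    IsIsometry (isometriesToElem F) φ := Subsingleton.elim _ _

/-- Linear in `𝒲` iff linear in `C`. [cite: MochizukiFrdII2008, Ex 3.3 (iii) p.29] -/
theorem isLinear_iff {X Y : WideSubcategory (isometricMorphisms F)} (φ : X ⟶ Y) :
    IsLinear (isometriesToElem F) φ ↔ IsLinear F φ.1 := Iff.rfl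

/-- Base-isomorphism in `𝒲` iff in `C`. [cite: MochizukiFrdII2008, Ex 3.3 (iii) p.29] -/
theorem isBaseIso_iff {X Y : WideSubcategory (isometricMorphisms F)} (φ : X ⟶ Y) :
    IsBaseIso (isometriesToElem F) φ ↔ IsBaseIso F φ.1 := Iff.rfl

/-- Pre-step in `𝒲` iff (isometric) pre-step in `C`. [cite: MochizukiFrdII2008, Ex 3.3 (iii) p.29] -/
theorem isPreStep_iff {X Y : WideSubcategory (isometricMorphisms F)} (φ : X ⟶ Y) :
    IsPreStep (isometriesToElem F) φ ↔ IsPreStep F φ.1 := Iff.rfl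

/-- Pre-steps of `𝒲` are the isometric pre-steps of `C`. [cite: MochizukiFrdII2008, Ex 3.3 (iii) p.29] -/
theorem isPreStep_iff_isIsometricPreStep {X Y : WideSubcategory (isometricMorphisms F)} (φ : X ⟶ Y) :
    IsPreStep (isometriesToElem F) φ ↔ IsIsometricPreStep F φ.1 :=
  ⟨fun h => ⟨φ.2, h⟩, fun h => h.2⟩

/-- Base objects agree. [cite: MochizukiFrdII2008, Ex 3.3 (iii) p.29] -/
theorem baseObj_eq (X : WideSubcategory (isometricMorphisms F)) :
    baseObj (isometriesToElem F) X = baseObj F X.obj := rfl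

/-! ### Isomorphisms -/

/-- An arrow of `𝒲` whose underlying arrow is invertible in `C` is invertible in `𝒲` (inverses of
isomorphisms are isometries). [cite: MochizukiFrdII2008, Ex 3.3 (iii) p.29] -/
theorem isIso_of_isIso_val (hP : IsPreFrobenioid Φ F) {X Y : WideSubcategory (isometricMorphisms F)}
    (φ : X ⟶ Y) [IsIso φ.1] : IsIso φ :=
  ⟨⟨⟨inv φ.1, isIsometry_of_isIso F hP (inv φ.1)⟩, WideSubcategory.hom_ext _ (IsIso.hom_inv_id φ.1),
    WideSubcategory.hom_ext _ (IsIso.inv_hom_id φ.1)⟩⟩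

/-- Underlying arrows of isomorphisms of `𝒲` are isomorphisms. [cite: MochizukiFrdII2008, Ex 3.3 (iii) p.29] -/
theorem isIso_val {X Y : WideSubcategory (isometricMorphisms F)} (φ : X ⟶ Y) [IsIso φ] :
    IsIso φ.1 :=
  inferInstanceAs (IsIso ((wideSubcategoryInclusion _).map φ))

/-- Isomorphic objects of `C` are isomorphic in `𝒲`. [cite: MochizukiFrdII2008, Ex 3.3 (iii) p.29] -/
theorem nonempty_iso_of_iso (hP : IsPreFrobenioid Φ F) {X Y : WideSubcategory (isometricMorphisms F)}
    (e : X.obj ≅ Y.obj) : ∃ j : X ≅ Y, j.hom.1 = e.hom :=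
  ⟨⟨⟨e.hom, isIsometry_of_isIso F hP e.hom⟩, ⟨e.inv, isIsometry_of_isIso F hP e.inv⟩,
    WideSubcategory.hom_ext _ e.hom_inv_id, WideSubcategory.hom_ext _ e.inv_hom_id⟩, rfl⟩

/-! ### Co-angular, Frobenius type, isotropic -/

/-- A co-angular isometry of `C` is co-angular in `𝒲`: factorisations in `𝒲` are factorisations in
`C` through an isometric pre-step. [cite: MochizukiFrdII2008, Ex 3.3 (iii) p.29] -/
theorem isCoAngular_of_val (hP : IsPreFrobenioid Φ F) {X Y : WideSubcategory (isometricMorphisms F)}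
    (φ : X ⟶ Y) (h : IsCoAngular F φ.1) : IsCoAngular (isometriesToElem F) φ := by
  intro X' Y' γ β α hfac hα _ hβp hbi
  have hfac' : γ.1 ≫ β.1 ≫ α.1 = φ.1 := congrArg (·.hom) hfac
  haveI : IsIso β.1 := h γ.1 β.1 α.1 hfac' hα β.2 hβp hbi
  exact isIso_of_isIso_val hP β

/-- Conversely a `𝒲`-co-angular arrow is co-angular in `C`: in a factorisation `φ = α ∘ β ∘ γ` of an
isometry all three factors are isometries ([FrdI] Prop. 1.7 (v): `Div(α ∘ β ∘ γ) = 0` in a sharp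
monoid with injective pull-backs), so the factorisation lies in `𝒲`.
[cite: MochizukiFrdII2008, Ex 3.3 (iii) p.29] -/
theorem isCoAngular_val (hP : IsPreFrobenioid Φ F) {X Y : WideSubcategory (isometricMorphisms F)}
    (φ : X ⟶ Y) (h : IsCoAngular (isometriesToElem F) φ) : IsCoAngular F φ.1 := by
  intro X' Y' γ β α hfac hα _ hβp hbi
  have hφi : IsIsometry F (γ ≫ β ≫ α) := by rw [hfac]; exact φ.2
  obtain ⟨hβα, hγ⟩ := isIsometry_factors F hP hφi
  obtain ⟨hα', hβ'⟩ := isIsometry_factors F hP hβα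
  let X₁ : WideSubcategory (isometricMorphisms F) := ⟨X'⟩
  let Y₁ : WideSubcategory (isometricMorphisms F) := ⟨Y'⟩
  let γ₁ : X ⟶ X₁ := ⟨γ, hγ⟩
  let β₁ : X₁ ⟶ Y₁ := ⟨β, hβ'⟩
  let α₁ : Y₁ ⟶ Y := ⟨α, hα'⟩
  have hfac₁ : γ₁ ≫ β₁ ≫ α₁ = φ := WideSubcategory.hom_ext _ hfac
  haveI := h γ₁ β₁ α₁ hfac₁ hα (isIsometry β₁) hβp hbi
  exact isIso_val β₁

/-- Co-angular in `𝒲` iff co-angular in `C`. [cite: MochizukiFrdII2008, Ex 3.3 (iii) p.29] -/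
theorem isCoAngular_iff (hP : IsPreFrobenioid Φ F) {X Y : WideSubcategory (isometricMorphisms F)}
    (φ : X ⟶ Y) : IsCoAngular (isometriesToElem F) φ ↔ IsCoAngular F φ.1 :=
  ⟨isCoAngular_val hP φ, isCoAngular_of_val hP φ⟩

/-- Co-angular pre-step in `𝒲` iff co-angular (isometric) pre-step in `C`.
[cite: MochizukiFrdII2008, Ex 3.3 (iii) p.29] -/
theorem isCoAngularPreStep_iff (hP : IsPreFrobenioid Φ F) {X Y : WideSubcategory (isometricMorphisms F)}
    (φ : X ⟶ Y) : IsCoAngularPreStep (isometriesToElem F) φ ↔ IsCoAngularPreStep F φ.1 :=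
  ⟨fun h => ⟨isCoAngular_val hP φ h.1, h.2⟩, fun h => ⟨isCoAngular_of_val hP φ h.1, h.2⟩⟩

/-- Frobenius type in `𝒲` iff Frobenius type in `C` (an isometry is LB-invertible iff co-angular).
[cite: MochizukiFrdII2008, Ex 3.3 (iii) p.29] -/
theorem isFrobeniusType_iff (hP : IsPreFrobenioid Φ F) {X Y : WideSubcategory (isometricMorphisms F)}
    (φ : X ⟶ Y) : IsFrobeniusType (isometriesToElem F) φ ↔ IsFrobeniusType F φ.1 :=
  ⟨fun h => ⟨⟨isCoAngular_val hP φ h.1.1, φ.2⟩, h.2⟩,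
    fun h => ⟨⟨isCoAngular_of_val hP φ h.1.1, isIsometry φ⟩, h.2⟩⟩

/-- Isotropic in `𝒲` iff isotropic in `C` (both say: every isometric pre-step out of the object is an
isomorphism). [cite: MochizukiFrdII2008, Ex 3.3 (iii) p.29] -/
theorem isIsotropic_iff (hP : IsPreFrobenioid Φ F) (X : WideSubcategory (isometricMorphisms F)) :
    IsIsotropic (isometriesToElem F) X ↔ IsIsotropic F X.obj := by
  constructor
  · intro h B ψ hψi hψp
    let B₁ : WideSubcategory (isometricMorphisms F) := ⟨B⟩
    let ψ₁ : X ⟶ B₁ := ⟨ψ, hψi⟩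
    haveI := h ψ₁ (isIsometry ψ₁) hψp
    exact isIso_val ψ₁
  · intro h B ψ _ hψp
    haveI := h ψ.1 ψ.2 hψp
    exact isIso_of_isIso_val hP ψ

/-! ### Pull-back morphisms -/

/-- A pull-back morphism of `C` which is an isometry is a pull-back morphism of `𝒲`: the lifts it
provides are isometries by two-out-of-three. [cite: MochizukiFrdII2008, Ex 3.3 (iii) p.29] -/
theorem isPullbackMorphism_of_val (hP : IsPreFrobenioid Φ F)
    {Y B : WideSubcategory (isometricMorphisms F)} (φ : Y ⟶ B) (h : IsPullbackMorphism F φ.1) :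
    IsPullbackMorphism (isometriesToElem F) φ := by
  intro X
  constructor
  · intro γ γ' e
    have h1 : γ ≫ φ = γ' ≫ φ :=
      congrArg (fun p : PullbackHomData (isometriesToElem F) φ X => p.1.1) e
    have h2 : Base F γ.1 = Base F γ'.1 :=
      congrArg (fun p : PullbackHomData (isometriesToElem F) φ X => p.1.2) e
    exact WideSubcategory.hom_ext _ (IsPullbackMorphism.hom_ext h (congrArg (·.hom) h1) h2)
  · rintro ⟨⟨ψ, g⟩, hg⟩
    obtain ⟨χ, hχ, hχb⟩ := h.exists_lift ψ.1 g hg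
    have hχi : IsIsometry F χ :=
      (isIsometry_factors F hP (show IsIsometry F (χ ≫ φ.1) by rw [hχ]; exact ψ.2)).2
    exact ⟨⟨χ, hχi⟩, Subtype.ext (Prod.ext (WideSubcategory.hom_ext _ hχ) hχb)⟩

/-- Def. 1.3 (i)(c) of `C`, read in `𝒲`: over every arrow `f : X₀ → B_D` there is a pull-back
morphism of `C` into `B` (an isometry, [FrdI] Def. 1.3 (iv)(b)) with `X_D ≅ X₀` over `B_D`.
[cite: MochizukiFrdII2008, Ex 3.3 (iii) p.29] -/
theorem exists_isPullbackMorphism_over (hF : IsFrobenioid F) (B : WideSubcategory (isometricMorphisms F))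
    {X₀ : D} (f : X₀ ⟶ baseObj F B.obj) :
    ∃ (X : WideSubcategory (isometricMorphisms F)) (ψ : X ⟶ B) (i : baseObj F X.obj ≅ X₀),
      IsPullbackMorphism F ψ.1 ∧ Base F ψ.1 = i.hom ≫ f := by
  obtain ⟨X, ψ, i, hψ, hb⟩ := PreFrobenioid.exists_isPullbackMorphism_over hF B.obj f
  obtain ⟨⟨_, hiso⟩, _⟩ := hF.iv_b ψ hψ
  exact ⟨⟨X⟩, ⟨ψ, hiso⟩, i, hψ, hb⟩

/-- A pull-back morphism of `𝒲` is a pull-back morphism of `C`: compare it with the pull-back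
morphism of `C` over the same base arrow — the two universal properties in `𝒲` make them
isomorphic. [cite: MochizukiFrdII2008, Ex 3.3 (iii) p.29] -/
theorem isPullbackMorphism_val (hF : IsFrobenioid F) {Y B : WideSubcategory (isometricMorphisms F)}
    (φ : Y ⟶ B) (h : IsPullbackMorphism (isometriesToElem F) φ) : IsPullbackMorphism F φ.1 := by
  have hP := hF.isPreFrobenioid
  obtain ⟨X, ψ, i, hψ, hb⟩ := exists_isPullbackMorphism_over hF B (Base F φ.1)
  have hψT := isPullbackMorphism_of_val hP ψ hψ
  obtain ⟨χ, hχ, hχb⟩ := IsPullbackMorphism.exists_lift (F := isometriesToElem F) h ψ i.hom hb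
  obtain ⟨χ', hχ', hχ'b⟩ := IsPullbackMorphism.exists_lift (F := isometriesToElem F) hψT φ i.inv
    (show Base F φ.1 = i.inv ≫ Base F ψ.1 by rw [hb]; exact (i.inv_hom_id_assoc _).symm)
  have h1 : χ' ≫ χ = 𝟙 Y :=
    IsPullbackMorphism.hom_ext (F := isometriesToElem F) h
      (by rw [Category.assoc, hχ, hχ', Category.id_comp])
      (by rw [base_comp, hχ'b, hχb, Iso.inv_hom_id, base_id])
  have h2 : χ ≫ χ' = 𝟙 X :=
    IsPullbackMorphism.hom_ext (F := isometriesToElem F) hψT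
      (by rw [Category.assoc, hχ', hχ, Category.id_comp])
      (by rw [base_comp, hχb, hχ'b, Iso.hom_inv_id, base_id])
  haveI : IsIso χ' := ⟨⟨χ, h1, h2⟩⟩
  haveI : IsIso χ'.1 := isIso_val χ'
  rw [show φ.1 = χ'.1 ≫ ψ.1 from (congrArg (·.hom) hχ').symm]
  exact IsPullbackMorphism.comp F (isPullbackMorphism_of_isIso F χ'.1) hψ

/-- Pull-back morphism in `𝒲` iff pull-back morphism in `C` (for `C` a Frobenioid).
[cite: MochizukiFrdII2008, Ex 3.3 (iii) p.29] -/
theorem isPullbackMorphism_iff (hF : IsFrobenioid F) {Y B : WideSubcategory (isometricMorphisms F)}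
    (φ : Y ⟶ B) : IsPullbackMorphism (isometriesToElem F) φ ↔ IsPullbackMorphism F φ.1 :=
  ⟨isPullbackMorphism_val hF φ, isPullbackMorphism_of_val hF.isPreFrobenioid φ⟩

end Isometries

end PreFrobenioid

end Literature.AlgebraicGeometry.Frobenioids
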